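import Summits.CriticalPhenomena.Ising3DConformalLimit.Theses.HyperoctahedralRP

/-!
# CriticalPhenomena / Ising3DConformalLimit — route HyperoctahedralRP, assembly

Settles item `stmt-CriticalPhenomena-1986` (rank 1, assembly of route
`route-CriticalPhenomena-HyperoctahedralRP`):

`HRP2Rigidity → LimitRotationInvariant → ExistsScaleCovariantLimit → InversionUpgradeNormalised →
IsingEuclidUpgradeR4NonGaussian → Ising3DConformalLimit`.

Pure logic over the summit's structure predicates
(`Literature/Probability/LatticeModels/ConformalCovariance.lean`,
`Literature/Probability/LatticeModels/ScalingLimit3D.lean`): take `ρ, Δ, S` from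
(C) `ExistsScaleCovariantLimit`; (B) `LimitRotationInvariant` applied to (A) `HRP2Rigidity` gives
`IsRotationInvariant S`, hence `IsEuclideanInvariant S := ⟨transl, rot⟩`; (D)
`InversionUpgradeNormalised` gives `IsInversionCovariant Δ S`; `IsMoebiusCovariant Δ S :=
⟨Euclid, scale, inversion⟩` by definition; (E) `IsingEuclidUpgradeR4NonGaussian` gives
`HasNontrivialU4 S`; conclude `CritIsing3DConformalLimit` (= `Ising3DConformalLimit`).
No named facts are used; the theorem is unconditional bookkeeping.
-/

namespace Summit.CriticalPhenomena.Ising3DConformalLimit.Theorems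

open Summit.CriticalPhenomena.Ising3DConformalLimit.Theses.HyperoctahedralRP
open Literature.Probability.LatticeModels

/-- Settles `stmt-CriticalPhenomena-1986` (exact signature): the assembly
`HRP2Rigidity → LimitRotationInvariant → ExistsScaleCovariantLimit → InversionUpgradeNormalised →
IsingEuclidUpgradeR4NonGaussian → Ising3DConformalLimit` of route HyperoctahedralRP.
Proof: `ρ, Δ, S` from (C); (B) (A) ⇒ `IsRotationInvariant S`; Euclidean := ⟨transl, rot⟩;
(D) ⇒ inversion covariance; Möbius := ⟨Euclid, scale, inversion⟩ (definition of
`IsMoebiusCovariant`, Di Francesco–Mathieu–Sénéchal 1997 §4.3.1); (E) ⇒ `U₄ ≢ 0`. [folklore] -/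
theorem hyperoctahedralRP_assembly_proof :
    Summit.CriticalPhenomena.Ising3DConformalLimit.Theses.HyperoctahedralRP.Assembly := by
  unfold Assembly
  intro hA hB hC hD hE
  obtain ⟨ρ, Δ, S, hρ, hΔ, hlim, hnorm, hnd, htr, hsc⟩ := hC
  have hrot : IsRotationInvariant S := hB hA ρ Δ S hρ hlim hnorm hnd htr hsc
  have heuc : IsEuclideanInvariant S := ⟨htr, hrot⟩
  have hinv : IsInversionCovariant Δ S := hD ρ Δ S hρ hlim hnorm hnd heuc hsc
  have hU4 : HasNontrivialU4 S := hE ρ S hρ hlim hnd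
  exact ⟨ρ, Δ, S, hρ, hΔ, hlim, hnd, ⟨heuc, hsc, hinv⟩, hU4⟩

end Summit.CriticalPhenomena.Ising3DConformalLimit.Theorems
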